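import Summits.Parity.GeneralizedHardyLittlewood.Theorems.GreenTaoLevelTwoGITwoCyclicInverseBogolyubovBohr

/-!
# Route `GreenTaoLevelTwo`, crux `GITwo` (stmt-Parity-21275), line `birth`, stub `stub_cyclicInverse`:
# small bridges for the local Bogolyubov lemma (GT08a arXiv Lemma 42)

Thirty-third helper file toward the XL stub `stub_cyclicInverse` (B. Green, T. Tao, *An inverse
theorem for the Gowers `U³(G)` norm*, arXiv:math/0503014, Thm. 68 = PEMS 51 (2008) Thm. 12.8).
Block B8: three def-free bridges used when the counting half of arXiv Lemma 42
(`…LocalBogolyubovCount`) is combined with the covering half (arXiv Cor. 41, `…LocalBesselDual`):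

* `half_le_re_stdAddChar_of_val`, `half_le_re_stdAddChar_of_norm_le` — the Bohr condition at
  radius `1/6` gives `Re e(y/M) = cos(2π‖y/M‖) ≥ ½`;
* `norm_sum_stdAddChar_eq_norm_dftCoeff` — `‖Σ_{y∈A} e(yξ/M)‖ = M ‖1̂_A(ξ)‖` (the large spectrum of
  `…LocalBesselDual` is the large spectrum of `…LocalBogolyubovCount`);
* `add_subset_bohr_add` — `A ⊆ B(S,ρ)`, `A' ⊆ B(S,ρ')` ⇒ `A + A' ⊆ B(S, ρ+ρ')`.

References: [GreenTao2008U3Inverse] arXiv:math/0503014, Lemma 42 (proof).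
-/

noncomputable section

open Finset ZMod
open scoped BigOperators ComplexConjugate Pointwise

namespace Summit.Parity.GeneralizedHardyLittlewood.GreenTaoLevelTwoGITwoCyclicInverse

open Literature.NumberTheory.Sieve

variable {M : ℕ} [NeZero M]

/-- The Bohr condition at radius `1/6` in `val` form gives `Re e(y/M) ≥ ½`: if `6·val(y) ≤ M` or
`6·val(y) ≥ 5M` then `cos(2π val(y)/M) ≥ cos(π/3) = ½`. [folklore] -/
theorem half_le_re_stdAddChar_of_val (y : ZMod M) (hy : 6 * y.val ≤ M ∨ 5 * M ≤ 6 * y.val) :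
    1 / 2 ≤ (stdAddChar y : ℂ).re := by
  have hMpos : (0 : ℝ) < M := by exact_mod_cast Nat.pos_of_ne_zero (NeZero.ne M)
  have hval : (y.val : ℝ) < M := by exact_mod_cast ZMod.val_lt y
  rw [stdAddChar_apply, toCircle_apply]
  have harg : (2 * (Real.pi : ℂ) * Complex.I * (y.val : ℂ) / (M : ℂ)) =
      ((2 * Real.pi * y.val / M : ℝ) : ℂ) * Complex.I := by
    push_cast
    ring
  rw [harg, Complex.exp_ofReal_mul_I_re, ← Real.cos_pi_div_three]
  rcases hy with h | h
  · have h' : (6 : ℝ) * y.val ≤ M := by exact_mod_cast h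
    apply Real.cos_le_cos_of_nonneg_of_le_pi
    · positivity
    · linarith [Real.pi_pos]
    · rw [div_le_iff₀ hMpos]
      nlinarith [Real.pi_pos]
  · have h' : (5 : ℝ) * M ≤ 6 * y.val := by exact_mod_cast h
    rw [← Real.cos_sub_two_pi (2 * Real.pi * y.val / M), ← Real.cos_neg (_ - _)]
    apply Real.cos_le_cos_of_nonneg_of_le_pi
    · rw [neg_sub, sub_nonneg, div_le_iff₀ hMpos]
      nlinarith [Real.pi_pos]
    · linarith [Real.pi_pos]
    · rw [neg_sub]
      have h5 : 5 * Real.pi / 3 ≤ 2 * Real.pi * y.val / M := by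
        rw [div_le_div_iff₀ (by norm_num : (0 : ℝ) < 3) hMpos]
        nlinarith [Real.pi_pos]
      linarith

/-- The Bohr condition `‖y/M‖_{ℝ/ℤ} ≤ 1/6` gives `Re e(y/M) ≥ ½`. [folklore] -/
theorem half_le_re_stdAddChar_of_norm_le (y : ZMod M) (hy : ‖ZMod.toAddCircle y‖ ≤ 1 / 6) :
    1 / 2 ≤ (stdAddChar y : ℂ).re := by
  have hM : (0 : ℝ) < M := by exact_mod_cast Nat.pos_of_ne_zero (NeZero.ne M)
  refine half_le_re_stdAddChar_of_val y ?_
  rw [norm_toAddCircle_eq_min, div_le_div_iff₀ hM (by norm_num), one_mul] at hy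
  have hy' : ((min y.val (M - y.val) : ℕ) : ℝ) * 6 ≤ M := hy
  have hnat : min y.val (M - y.val) * 6 ≤ M := by exact_mod_cast hy'
  have hv := ZMod.val_lt y
  rcases le_total y.val (M - y.val) with h | h
  · rw [min_eq_left h] at hnat
    left; omega
  · rw [min_eq_right h] at hnat
    right; omega

/-- `‖Σ_{y∈A} e(yξ/M)‖ = M · ‖1̂_A(ξ)‖` (the normalised Fourier coefficient of the sibling files is
`1̂_A(ξ) = M⁻¹ Σ_{y∈A} e(−yξ/M)`). [folklore] -/
theorem norm_sum_stdAddChar_eq_norm_dftCoeff (A : Finset (ZMod M)) (ξ : ZMod M) :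
    ‖∑ y ∈ A, (stdAddChar (y * ξ) : ℂ)‖ =
      M * ‖dftCoeff (fun y => if y ∈ A then (1 : ℝ) else 0) ξ‖ := by
  have hM : (M : ℝ) ≠ 0 := by exact_mod_cast NeZero.ne M
  unfold dftCoeff
  rw [sum_indicator_mul A, norm_div, Complex.norm_natCast, mul_div_cancel₀ _ hM]
  -- `Σ e(−yξ) = conj Σ e(yξ)`
  have h : ∑ y ∈ A, (stdAddChar (-(y * ξ)) : ℂ) = conj (∑ y ∈ A, (stdAddChar (y * ξ) : ℂ)) := by
    rw [map_sum]
    refine sum_congr rfl fun y _ => ?_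
    rw [stdAddChar_apply, stdAddChar_apply, AddChar.map_neg_eq_inv, Circle.coe_inv_eq_conj]
  rw [h, Complex.norm_conj]

/-- `A ⊆ B(S,ρ)` and `A' ⊆ B(S,ρ')` give `A + A' ⊆ B(S, ρ + ρ')`. [folklore] -/
theorem add_subset_bohr_add (S A A' : Finset (ZMod M)) {ρ ρ' : ℝ}
    (hA : ∀ a ∈ A, ∀ ξ ∈ S, ‖ZMod.toAddCircle (a * ξ)‖ < ρ)
    (hA' : ∀ a ∈ A', ∀ ξ ∈ S, ‖ZMod.toAddCircle (a * ξ)‖ < ρ') :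
    A + A' ⊆ ({x : ZMod M | ∀ ξ ∈ S, ‖ZMod.toAddCircle (x * ξ)‖ < ρ + ρ'} : Finset (ZMod M)) := by
  classical
  intro x hx
  rw [Finset.mem_add] at hx
  obtain ⟨a, ha, a', ha', rfl⟩ := hx
  rw [mem_filter]
  refine ⟨mem_univ _, fun ξ hξ => ?_⟩
  rw [add_mul, map_add]
  exact (norm_add_le _ _).trans_lt (add_lt_add (hA a ha ξ hξ) (hA' a' ha' ξ hξ))

end Summit.Parity.GeneralizedHardyLittlewood.GreenTaoLevelTwoGITwoCyclicInverse
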